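import Summits.BirchSwinnertonDyer.Rank1Residual.X11b.AnticyclotomicModuleFinite
import Summits.BirchSwinnertonDyer.Rank1Residual.X11b.AnticyclotomicEulerChar
import Summits.BirchSwinnertonDyer.Rank1Residual.X11b.HalvesReceptacle
import Literature.NumberTheory.EllipticCurves.IwasawaModuleFinitePadicIntProofs
import Literature.NumberTheory.EllipticCurves.IwasawaAlgebraMuVanishingProofs
import HarnessLib

/-!
# Route UniversalToricDescent — the `Λ`-side of the port-grade algebraic half of child 20399 /
# `InvariantsTransportModThreeT`: Greenberg's criterion (A) for Castella's anticyclotomic Selmer dual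
# `X = AcSelmer.XAc W p κ 𝔭 Σ γ` and its reading in the route's `R₀⟦T⟧`-currency

Lead prover bsd-wall-utd-p1 g6 (`--supports stmt-BirchSwinnertonDyer-20399`; PRICING-20399-ALG-HALF-utdp1g5
§3(a)/§8, bricks (i) of the porting map, now ON THE ROUTE'S OBJECT). For every elliptic curve `W` over a
number field `K`, every prime `p`, every `ℤ_p`-extension `κ` with topological generator `γ`, every place `𝔭`
and every FINITE imprimitivity set `Σ` (so that `X` is a finitely generated `Λ`-module, tree
`AcSelmer.XAc.module_finite`):

* §1 `finite_quotient_augIdealP_of_finite_pTorsion`: `Sel_𝔭^Σ(K_∞, E[p^∞])[p]` finite ⟹ `X/(p)X` finite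
  (exactness of Pontryagin duality at `p`, tree `IwasawaDual.finite_quotient_pSmul_of_finite_pTorsion` for the
  dual pair `AcSelmer.XAc.isDualPair`); hence (`isTorsion_of_finite_pTorsion`,
  `muInvariant_eq_zero_of_finite_pTorsion`, `moduleFinite_padicInt_of_finite_pTorsion`) **`X` is `Λ`-torsion,
  `μ(X) = 0`, and `X` is finitely generated over `ℤ_p`** (tree bricks `IwasawaModuleFinitePadicInt.*`,
  Greenberg LNM 1716 §1 p. 60 / Greenberg–Vatsal Prop. (2.8) shape); conversely
  (`finite_pTorsion_of_moduleFinite_padicInt`) `X` finitely generated over `ℤ_p` ⟹ `Sel[p]` finite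
  (evaluation of characters at `ℤ_p`-generators), so `moduleFinite_padicInt_iff_finite_pTorsion`.
* §2 the `R₀⟦T⟧`-currency of the route (`Ch_Λ(X)·R₀⟦T⟧ = (g)` with a norm-one coefficient of `g`):
  for finitely generated torsion `X`, **`μ(X) = 0` iff the extended characteristic ideal
  `Ch_Λ(X)·R₀⟦T⟧` is generated by a power series with a coefficient of norm `1`**
  (`exists_map_charIdeal_eq_span_of_muInvariant_eq_zero`, `muInvariant_eq_zero_of_map_charIdeal_eq_span`;
  `Ch_Λ(X)` is principal, tree `charIdeal_isPrincipal_holds`; `μ = 0 ⟺` a unit coefficient, tree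
  `muInvariant_eq_zero_iff_exists_isUnit_coeff_of_charIdeal_eq_span`; `‖toUnr x‖ = ‖x‖`).
* §3 the two directions packaged in the binder shape of the route's children
  (`isTorsion_and_exists_generator_of_finite_pTorsion`, `finite_pTorsion_of_isTorsion_of_exists_generator`) and
  the TRANSFER SCHEMA `torsionMuTransfer_of_finite_pTorsion_transfer`: for two curves `W₁, W₂` over `K`, the
  implication «`Sel(W₁)[p]` finite ⟹ `Sel(W₂)[p]` finite» (the residual Selmer comparison, Galois cohomology)
  ALREADY GIVES «`X(W₁)` torsion with `Ch·R₀⟦T⟧ = (g₁)`, `g₁` with a norm-one coefficient ⟹ the same for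
  `X(W₂)`», i.e. the `Λ`-algebra of the port-grade child B′1 `TorsionMuTransportModThree` of 20399 is
  DISCHARGED here; what remains of B′1 is the residual comparison alone.

THEOREMS ONLY; no definition, no named fact, no `sorry`; imports no `Theses` module. BSD is not advanced by
this file (it is `Λ`-module bookkeeping on a constructed object).
References: [GreenbergLNM1716] §1 p. 60; [GreenbergVatsal2000] §2 Prop. (2.8), p. 2 (1)–(2);
[Washington1997] §13.2; [Castella2018] §2.1–2.2, Thm. 2.3; [LimSujatha2018] §3 (before Prop. 3.2).
-/

noncomputable section

open scoped Classical

-- `…BirchSwinnertonDyer.BirchSwinnertonDyer.Theorems…` is the problem's mandated namespace (D-0017).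
set_option linter.dupNamespace false
set_option autoImplicit false

namespace Summit.BirchSwinnertonDyer.BirchSwinnertonDyer.Theorems.UniversalToricDescentAcDualMuZero

open Literature.NumberTheory.EllipticCurves Literature.NumberTheory.EllipticCurves.IwasawaAlgebra
  Literature.NumberTheory.EllipticCurves.IwasawaModuleFinitePadicInt
  Literature.NumberTheory.GaloisRepresentations NumberField IsDedekindDomain Field
  Summit.BirchSwinnertonDyer.Rank1Residual.X11b Summit.BirchSwinnertonDyer.Rank1Residual.X11b.AcSelmer

universe u

variable {K : Type u} [Field K] [NumberField K]

/-! ### §1 Greenberg's criterion (A) for `X_ac^Σ(E[p^∞])` -/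

section CriterionA

variable (W : WeierstrassCurve K) (p : ℕ) [hp : Fact p.Prime]
  (κ : ZpExtension K p) (𝔭 : HeightOneSpectrum (𝓞 K)) (S : Set (HeightOneSpectrum (𝓞 K)))
  (γ : absoluteGaloisGroup K) [hγ : Fact (κ.IsTopGenerator γ)]

/-- **`Sel_𝔭^Σ(K_∞, E[p^∞])[p]` finite ⟹ `X/(p)X` finite** for `X = X_ac^Σ(E[p^∞])`: exactness of Pontryagin
duality at `p` (`(X/pX)^∨ = Sel[p]`, tree `IwasawaDual.finite_quotient_pSmul_of_finite_pTorsion`) for the dual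
pair `XAc.isDualPair` (`toDual = id`). [cite: GreenbergLNM1716, §1 p. 60 (after Conj. 1.3)] -/
theorem finite_quotient_augIdealP_of_finite_pTorsion
    (hfin : Set.Finite {s : selmerAc W p κ 𝔭 S | p • s = 0}) :
    Finite (XAc W p κ 𝔭 S γ ⧸
      (augIdealP p • (⊤ : Submodule (IwasawaAlgebra p) (XAc W p κ 𝔭 S γ)))) :=
  IwasawaDual.finite_quotient_pSmul_of_finite_pTorsion (XAc.isDualPair W p κ 𝔭 S γ).bijective
    (XAc.isDualPair W p κ 𝔭 S γ).C_smul (selmerAc_exists_pow_smul_eq_zero W p κ 𝔭 S) hfin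

/-- **`Sel_𝔭^Σ(K_∞, E[p^∞])[p]` finite ⟹ `X_ac^Σ(E[p^∞])` is a torsion `Λ`-module** (finite `Σ`): `X` is
finitely generated over `Λ` (tree `XAc.module_finite`) with `X/(p)X` finite, hence torsion (tree
`isTorsion_of_finite_quotient_augIdealP`, Greenberg's "if `X/TX` is finite then `X` is `Λ`-torsion" at `p`).
[cite: GreenbergLNM1716, §1 p. 61 and Prop. 5.10 (proof)] -/
theorem isTorsion_of_finite_pTorsion [W.IsElliptic] (hS : S.Finite)
    (hfin : Set.Finite {s : selmerAc W p κ 𝔭 S | p • s = 0}) :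
    Module.IsTorsion (IwasawaAlgebra p) (XAc W p κ 𝔭 S γ) := by
  haveI := XAc.module_finite κ 𝔭 S γ hS (W := W)
  exact isTorsion_of_finite_quotient_augIdealP p (XAc W p κ 𝔭 S γ)
    (finite_quotient_augIdealP_of_finite_pTorsion W p κ 𝔭 S γ hfin)

/-- **`Sel_𝔭^Σ(K_∞, E[p^∞])[p]` finite ⟹ `μ(X_ac^Σ(E[p^∞])) = 0`** (finite `Σ`; Greenberg–Vatsal Prop. (2.8),
the `μ`-half, on Castella's object: tree `muInvariant_eq_zero_of_finite_quotient_augIdealP`).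
[cite: GreenbergVatsal2000, §2 Prop. (2.8)] [cite: Washington1997, §13.2] -/
theorem muInvariant_eq_zero_of_finite_pTorsion [W.IsElliptic] (hS : S.Finite)
    (hfin : Set.Finite {s : selmerAc W p κ 𝔭 S | p • s = 0}) :
    muInvariant p (XAc W p κ 𝔭 S γ) = 0 := by
  haveI := XAc.module_finite κ 𝔭 S γ hS (W := W)
  exact muInvariant_eq_zero_of_finite_quotient_augIdealP p (XAc W p κ 𝔭 S γ)
    (isTorsion_of_finite_pTorsion W p κ 𝔭 S γ hS hfin)
    (finite_quotient_augIdealP_of_finite_pTorsion W p κ 𝔭 S γ hfin)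

/-- **(A) for `X_ac^Σ(E[p^∞])`: `Sel_𝔭^Σ(K_∞, E[p^∞])[p]` finite ⟹ `X` is finitely generated over `ℤ_p`**
(finite `Σ`; torsion with `μ = 0`, Washington §13.2; tree `moduleFinite_padicInt_of_finite_quotient_augIdealP`).
[cite: Washington1997, §13.2] [cite: GreenbergLNM1716, §1 p. 60] -/
theorem moduleFinite_padicInt_of_finite_pTorsion [W.IsElliptic] (hS : S.Finite)
    (hfin : Set.Finite {s : selmerAc W p κ 𝔭 S | p • s = 0}) :
    Module.Finite ℤ_[p] (RestrictScalars ℤ_[p] (IwasawaAlgebra p) (XAc W p κ 𝔭 S γ)) := by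
  haveI := XAc.module_finite κ 𝔭 S γ hS (W := W)
  exact moduleFinite_padicInt_of_finite_quotient_augIdealP p (XAc W p κ 𝔭 S γ)
    (finite_quotient_augIdealP_of_finite_pTorsion W p κ 𝔭 S γ hfin)

/-- **Converse of (A): `X_ac^Σ(E[p^∞])` finitely generated over `ℤ_p` ⟹ `Sel_𝔭^Σ(K_∞, E[p^∞])[p]` finite**
(any `Σ`): with `ℤ_p`-generators `x₁, …, xₙ` of `X`, `s ↦ (xᵢ(s))ᵢ` embeds `Sel[p]` into the finite
`(ℚ/ℤ[p])ⁿ` — a character vanishing at `s − s'` on every generator vanishes there identically (constants act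
through `ℤ_p → ℤ/p` on values at `p`-torsion classes, `XAc.C_smul_apply`), and characters separate points.
Verbatim the tree's `finite_pTorsion_of_fineSelmerDualData_moduleFinite` for the fine Selmer group.
[cite: LimSujatha2018, §3 (before Prop. 3.2)] [cite: GreenbergLNM1716, §1 p. 60] -/
theorem finite_pTorsion_of_moduleFinite_padicInt
    (hD : Module.Finite ℤ_[p] (RestrictScalars ℤ_[p] (IwasawaAlgebra p) (XAc W p κ 𝔭 S γ))) :
    Set.Finite {s : selmerAc W p κ 𝔭 S | p • s = 0} := by
  obtain ⟨G, hG⟩ := hD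
  have hT : {u : AddCircle (1 : ℚ) | p • u = 0}.Finite := AddCircle.finite_torsion (1 : ℚ) hp.out.pos
  haveI : Finite {u : AddCircle (1 : ℚ) | p • u = 0} := hT.to_subtype
  -- the identification `RestrictScalars ℤ_p Λ X = X` (a type synonym)
  let toX : RestrictScalars ℤ_[p] (IwasawaAlgebra p) (XAc W p κ 𝔭 S γ) → XAc W p κ 𝔭 S γ := fun x ↦ x
  have hadd : ∀ (x y : RestrictScalars ℤ_[p] (IwasawaAlgebra p) (XAc W p κ 𝔭 S γ))
      (t : selmerAc W p κ 𝔭 S), toX (x + y) t = toX x t + toX y t := fun _ _ _ ↦ rfl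
  have hzero : ∀ t : selmerAc W p κ 𝔭 S,
      toX (0 : RestrictScalars ℤ_[p] (IwasawaAlgebra p) (XAc W p κ 𝔭 S γ)) t = 0 := fun _ ↦ rfl
  have hsmul : ∀ (c : ℤ_[p]) (x : RestrictScalars ℤ_[p] (IwasawaAlgebra p) (XAc W p κ 𝔭 S γ)),
      toX (c • x) = (PowerSeries.C c : IwasawaAlgebra p) • toX x := fun _ _ ↦ rfl
  -- evaluation at the generators
  let ev : {s : selmerAc W p κ 𝔭 S | p • s = 0} →
      ({x : RestrictScalars ℤ_[p] (IwasawaAlgebra p) (XAc W p κ 𝔭 S γ) // x ∈ G} →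
        {u : AddCircle (1 : ℚ) | p • u = 0}) :=
    fun s x ↦ ⟨toX x.1 s.1, by
      change p • toX x.1 s.1 = 0
      rw [← map_nsmul, s.2, map_zero]⟩
  refine Set.finite_coe_iff.mp (Finite.of_injective ev fun s s' hss' ↦ ?_)
  -- a character agreeing at `s`, `s'` on all generators agrees there identically
  have hgen : ∀ x : RestrictScalars ℤ_[p] (IwasawaAlgebra p) (XAc W p κ 𝔭 S γ),
      toX x (s.1 : selmerAc W p κ 𝔭 S) = toX x (s'.1 : selmerAc W p κ 𝔭 S) := by
    intro x
    have hx : x ∈ Submodule.span ℤ_[p]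
        (G : Set (RestrictScalars ℤ_[p] (IwasawaAlgebra p) (XAc W p κ 𝔭 S γ))) := by
      rw [hG]; exact Submodule.mem_top
    refine Submodule.span_induction (M := RestrictScalars ℤ_[p] (IwasawaAlgebra p) (XAc W p κ 𝔭 S γ))
      (p := fun y _ ↦ toX y (s.1 : selmerAc W p κ 𝔭 S) = toX y (s'.1 : selmerAc W p κ 𝔭 S))
      ?_ ?_ ?_ ?_ hx
    · intro y hy
      have := congrArg (fun f ↦ ((f ⟨y, Finset.mem_coe.mp hy⟩ : {u : AddCircle (1 : ℚ) | p • u = 0}) :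
        AddCircle (1 : ℚ))) hss'
      exact this
    · rw [hzero, hzero]
    · intro y z _ _ hy hz
      rw [hadd, hadd, hy, hz]
    · intro c y _ hy
      have h1 : p ^ 1 • (s.1 : selmerAc W p κ 𝔭 S) = 0 := by rw [pow_one]; exact s.2
      have h2 : p ^ 1 • (s'.1 : selmerAc W p κ 𝔭 S) = 0 := by rw [pow_one]; exact s'.2
      rw [hsmul, XAc.C_smul_apply W p κ 𝔭 S γ c _ h1, XAc.C_smul_apply W p κ 𝔭 S γ c _ h2, hy]
  -- characters separate points of `Sel`
  apply Subtype.ext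
  by_contra hne
  have hne' : (s.1 : selmerAc W p κ 𝔭 S) - s'.1 ≠ 0 := sub_ne_zero.mpr hne
  obtain ⟨χ, hχ⟩ := CharacterModule.exists_character_apply_ne_zero_of_ne_zero hne'
  apply hχ
  rw [map_sub, sub_eq_zero]
  exact hgen (χ : XAc W p κ 𝔭 S γ)

/-- **Greenberg's criterion (A) for `X_ac^Σ(E[p^∞])`** (finite `Σ`): `X` is finitely generated over `ℤ_p`
iff `Sel_𝔭^Σ(K_∞, E[p^∞])[p]` is finite ("`Y(E/F_∞)` is finitely generated over `ℤ_p` iff `R(E/F_∞)[p]` is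
finite", Lim–Sujatha §3, here for Castella's anticyclotomic Selmer group).
[cite: LimSujatha2018, §3 (before Prop. 3.2)] [cite: GreenbergLNM1716, §1 p. 60] -/
theorem moduleFinite_padicInt_iff_finite_pTorsion [W.IsElliptic] (hS : S.Finite) :
    Module.Finite ℤ_[p] (RestrictScalars ℤ_[p] (IwasawaAlgebra p) (XAc W p κ 𝔭 S γ)) ↔
      Set.Finite {s : selmerAc W p κ 𝔭 S | p • s = 0} :=
  ⟨finite_pTorsion_of_moduleFinite_padicInt W p κ 𝔭 S γ,
    moduleFinite_padicInt_of_finite_pTorsion W p κ 𝔭 S γ hS⟩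

/-- **For finitely generated torsion `X_ac^Σ` with `μ = 0`, `Sel[p]` is finite** (Washington §13.2: `μ = 0`
iff finitely generated over `ℤ_p`; then §1's converse). [cite: Washington1997, §13.2] -/
theorem finite_pTorsion_of_muInvariant_eq_zero [Module.Finite (IwasawaAlgebra p) (XAc W p κ 𝔭 S γ)]
    (hT : Module.IsTorsion (IwasawaAlgebra p) (XAc W p κ 𝔭 S γ))
    (hμ : muInvariant p (XAc W p κ 𝔭 S γ) = 0) :
    Set.Finite {s : selmerAc W p κ 𝔭 S | p • s = 0} :=
  finite_pTorsion_of_moduleFinite_padicInt W p κ 𝔭 S γ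
    ((muInvariant_eq_zero_iff_holds p (XAc W p κ 𝔭 S γ) hT).mp hμ)

end CriterionA

/-! ### §2 `μ = 0` in the `R₀⟦T⟧`-currency of the route -/

section Currency

variable {p : ℕ} [hp : Fact p.Prime]

/-- `‖toUnr x‖ = ‖x‖`: the structure map `ℤ_p → R₀ ⊂ ℂ_p` is isometric. [folklore] -/
theorem norm_coe_toUnr (x : ℤ_[p]) : ‖((Halves.toUnr p x : unrIntegers p) : ℂ_[p])‖ = ‖x‖ := by
  rw [Halves.coe_toUnr, norm_algebraMap', PadicInt.norm_def]

/-- A coefficient of `f ∈ Λ` is a unit of `ℤ_p` iff its image in `R₀` has norm `1`. [folklore] -/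
theorem isUnit_coeff_iff_norm_toUnr_eq_one (f : IwasawaAlgebra p) (n : ℕ) :
    IsUnit (PowerSeries.coeff n f) ↔
      ‖((PowerSeries.coeff n (PowerSeries.map (Halves.toUnr p) f) : unrIntegers p) : ℂ_[p])‖ = 1 := by
  rw [PowerSeries.coeff_map, norm_coe_toUnr, PadicInt.isUnit_iff]

/-- Extension of a principal ideal of `Λ` to `R₀⟦T⟧` is principal on the image of the generator. [folklore] -/
theorem map_span_singleton_toUnr (f : IwasawaAlgebra p) :
    (Ideal.span ({f} : Set (IwasawaAlgebra p))).map (PowerSeries.map (Halves.toUnr p)) =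
      Ideal.span {PowerSeries.map (Halves.toUnr p) f} := by
  rw [Ideal.map_span, Set.image_singleton]

variable (M : Type*) [AddCommGroup M] [Module (IwasawaAlgebra p) M] [Module.Finite (IwasawaAlgebra p) M]

/-- **`μ(M) = 0` ⟹ `Ch_Λ(M)·R₀⟦T⟧ = (g)` for some `g ∈ R₀⟦T⟧` with a coefficient of norm `1`** (finitely
generated torsion `M`): `Ch_Λ(M) = (f)` is principal (tree `charIdeal_isPrincipal_holds`), `μ = 0` gives a unit
coefficient of `f` (tree `muInvariant_eq_zero_iff_exists_isUnit_coeff_of_charIdeal_eq_span`), and `g = f`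
read in `R₀⟦T⟧`. [cite: GreenbergVatsal2000, p. 2, (1)–(2)] [cite: Washington1997, §13.2] -/
theorem exists_map_charIdeal_eq_span_of_muInvariant_eq_zero (hM : Module.IsTorsion (IwasawaAlgebra p) M)
    (hμ : muInvariant p M = 0) :
    ∃ g : UnrSeries p,
      (Module.charIdeal (IwasawaAlgebra p) M).map (PowerSeries.map (Halves.toUnr p)) = Ideal.span {g} ∧
        ∃ i : ℕ, ‖((PowerSeries.coeff i g : unrIntegers p) : ℂ_[p])‖ = 1 := by
  obtain ⟨f, hf⟩ := (charIdeal_isPrincipal_holds p M).principal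
  have hf' : Module.charIdeal (IwasawaAlgebra p) M = Ideal.span {f} := hf
  obtain ⟨n, hn⟩ := (muInvariant_eq_zero_iff_exists_isUnit_coeff_of_charIdeal_eq_span M hM hf').mp hμ
  refine ⟨PowerSeries.map (Halves.toUnr p) f, ?_, n, (isUnit_coeff_iff_norm_toUnr_eq_one f n).mp hn⟩
  rw [hf', map_span_singleton_toUnr]

/-- **`Ch_Λ(M)·R₀⟦T⟧ = (g)` with a norm-one coefficient of `g` ⟹ `μ(M) = 0`** (finitely generated torsion
`M`): with `Ch_Λ(M) = (f)`, `g` is associated with the image of `f` in the domain `R₀⟦T⟧`; if `p ∣ f` in `Λ`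
(i.e. `μ ≠ 0`, tree `muInvariant_eq_zero_iff_not_C_dvd_of_charIdeal_eq_span`) then `p` divides every
coefficient of `g` in `R₀`, so all have norm `≤ ‖p‖ < 1`. [cite: GreenbergVatsal2000, p. 2, (1)–(2)] [cite: Washington1997, §13.2] -/
theorem muInvariant_eq_zero_of_map_charIdeal_eq_span (hM : Module.IsTorsion (IwasawaAlgebra p) M)
    {g : UnrSeries p}
    (hg : (Module.charIdeal (IwasawaAlgebra p) M).map (PowerSeries.map (Halves.toUnr p)) = Ideal.span {g})
    (hi : ∃ i : ℕ, ‖((PowerSeries.coeff i g : unrIntegers p) : ℂ_[p])‖ = 1) :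
    muInvariant p M = 0 := by
  obtain ⟨f, hf⟩ := (charIdeal_isPrincipal_holds p M).principal
  have hf' : Module.charIdeal (IwasawaAlgebra p) M = Ideal.span {f} := hf
  rw [muInvariant_eq_zero_iff_not_C_dvd_of_charIdeal_eq_span M hM hf']
  rintro ⟨h, rfl⟩
  obtain ⟨i, hi⟩ := hi
  rw [hf', map_span_singleton_toUnr] at hg
  -- `g = (p · h)^♮ · u` for a unit `u` of `R₀⟦T⟧`
  obtain ⟨u, hu⟩ := Ideal.span_singleton_eq_span_singleton.mp hg
  have hmap : PowerSeries.map (Halves.toUnr p) (PowerSeries.C (p : ℤ_[p]) * h) =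
      PowerSeries.C (Halves.toUnr p (p : ℤ_[p])) * PowerSeries.map (Halves.toUnr p) h := by
    rw [map_mul, PowerSeries.map_C]
  have hcoeff : PowerSeries.coeff i g = Halves.toUnr p (p : ℤ_[p]) *
      PowerSeries.coeff i (PowerSeries.map (Halves.toUnr p) h * (u : UnrSeries p)) := by
    rw [← hu, hmap, mul_assoc, PowerSeries.coeff_C_mul]
  have hlt : ‖((PowerSeries.coeff i g : unrIntegers p) : ℂ_[p])‖ < 1 := by
    rw [hcoeff, Subring.coe_mul, norm_mul, norm_coe_toUnr]
    calc ‖(p : ℤ_[p])‖ * ‖((PowerSeries.coeff i (PowerSeries.map (Halves.toUnr p) h * (u : UnrSeries p)) :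
            unrIntegers p) : ℂ_[p])‖
        ≤ ‖(p : ℤ_[p])‖ * 1 :=
          mul_le_mul_of_nonneg_left (Halves.norm_coe_unrIntegers_le_one p _) (norm_nonneg _)
      _ < 1 := by rw [mul_one, PadicInt.norm_p]; exact inv_lt_one_of_one_lt₀ (by exact_mod_cast hp.out.one_lt)
  exact absurd hi hlt.ne

/-- **`μ(M) = 0` iff `Ch_Λ(M)·R₀⟦T⟧` has a generator with a norm-one coefficient** (finitely generated torsion
`M`). [cite: GreenbergVatsal2000, p. 2, (1)–(2)] [cite: Washington1997, §13.2] -/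
theorem muInvariant_eq_zero_iff_exists_map_charIdeal_eq_span (hM : Module.IsTorsion (IwasawaAlgebra p) M) :
    muInvariant p M = 0 ↔
      ∃ g : UnrSeries p,
        (Module.charIdeal (IwasawaAlgebra p) M).map (PowerSeries.map (Halves.toUnr p)) = Ideal.span {g} ∧
          ∃ i : ℕ, ‖((PowerSeries.coeff i g : unrIntegers p) : ℂ_[p])‖ = 1 :=
  ⟨exists_map_charIdeal_eq_span_of_muInvariant_eq_zero M hM,
    fun ⟨_, hg, hi⟩ ↦ muInvariant_eq_zero_of_map_charIdeal_eq_span M hM hg hi⟩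

end Currency

/-! ### §3 The binder shapes of the route's children and the transfer schema -/

section Route

variable (W : WeierstrassCurve K) (p : ℕ) [hp : Fact p.Prime]
  (κ : ZpExtension K p) (𝔭 : HeightOneSpectrum (𝓞 K)) (S : Set (HeightOneSpectrum (𝓞 K)))
  (γ : absoluteGaloisGroup K) [hγ : Fact (κ.IsTopGenerator γ)]

/-- **`Sel_𝔭^Σ(K_∞, E[p^∞])[p]` finite ⟹ `X_ac^Σ` is `Λ`-torsion and `Ch_Λ(X_ac^Σ)·R₀⟦T⟧ = (g)` with a
norm-one coefficient of `g`** — the conclusion shape of the route's transport children (finite `Σ`).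
[cite: GreenbergVatsal2000, §2 Prop. (2.8)] [cite: Washington1997, §13.2] -/
theorem isTorsion_and_exists_generator_of_finite_pTorsion [W.IsElliptic] (hS : S.Finite)
    (hfin : Set.Finite {s : selmerAc W p κ 𝔭 S | p • s = 0}) :
    Module.IsTorsion (IwasawaAlgebra p) (XAc W p κ 𝔭 S γ) ∧
      ∃ g : UnrSeries p,
        (XAc.charIdeal W p κ 𝔭 S γ).map (PowerSeries.map (Halves.toUnr p)) = Ideal.span {g} ∧
          ∃ i : ℕ, ‖((PowerSeries.coeff i g : unrIntegers p) : ℂ_[p])‖ = 1 := by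
  haveI := XAc.module_finite κ 𝔭 S γ hS (W := W)
  have hT := isTorsion_of_finite_pTorsion W p κ 𝔭 S γ hS hfin
  exact ⟨hT, exists_map_charIdeal_eq_span_of_muInvariant_eq_zero (XAc W p κ 𝔭 S γ) hT
    (muInvariant_eq_zero_of_finite_pTorsion W p κ 𝔭 S γ hS hfin)⟩

/-- **`X_ac^Σ` `Λ`-torsion with `Ch_Λ(X_ac^Σ)·R₀⟦T⟧ = (g)`, `g` with a norm-one coefficient ⟹
`Sel_𝔭^Σ(K_∞, E[p^∞])[p]` finite** — the hypothesis shape of the route's transport children on the TWIN, read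
back as finiteness of the residual Selmer group (finite `Σ`). [cite: Washington1997, §13.2] [cite: LimSujatha2018, §3 (before Prop. 3.2)] -/
theorem finite_pTorsion_of_isTorsion_of_exists_generator [W.IsElliptic] (hS : S.Finite)
    (hT : Module.IsTorsion (IwasawaAlgebra p) (XAc W p κ 𝔭 S γ))
    (hg : ∃ g : UnrSeries p,
      (XAc.charIdeal W p κ 𝔭 S γ).map (PowerSeries.map (Halves.toUnr p)) = Ideal.span {g} ∧
        ∃ i : ℕ, ‖((PowerSeries.coeff i g : unrIntegers p) : ℂ_[p])‖ = 1) :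
    Set.Finite {s : selmerAc W p κ 𝔭 S | p • s = 0} := by
  haveI := XAc.module_finite κ 𝔭 S γ hS (W := W)
  obtain ⟨g, hg, hi⟩ := hg
  exact finite_pTorsion_of_muInvariant_eq_zero W p κ 𝔭 S γ hT
    (muInvariant_eq_zero_of_map_charIdeal_eq_span (XAc W p κ 𝔭 S γ) hT hg hi)

/-- **TRANSFER SCHEMA (the `Λ`-algebra of the port-grade child B′1 of 20399, discharged).** For two elliptic
curves `W₁, W₂` over `K` and a finite `Σ`: if the RESIDUAL comparison «`Sel_𝔭^Σ(K_∞, W₁[p^∞])[p]` finite ⟹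
`Sel_𝔭^Σ(K_∞, W₂[p^∞])[p]` finite» holds, then «`X(W₁)` torsion with `Ch·R₀⟦T⟧ = (g₁)`, `g₁` with a norm-one
coefficient» implies the same for `X(W₂)`. (Greenberg–Vatsal's "whether `μ = 0` and `Sel` is cotorsion is
determined by `E[p]`", the `Λ`-module half.) [cite: GreenbergVatsal2000, §2 Prop. (2.8) and p. 26] -/
theorem torsionMuTransfer_of_finite_pTorsion_transfer (W₁ W₂ : WeierstrassCurve K) [W₁.IsElliptic]
    [W₂.IsElliptic] (hS : S.Finite)
    (htr : Set.Finite {s : selmerAc W₁ p κ 𝔭 S | p • s = 0} →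
      Set.Finite {s : selmerAc W₂ p κ 𝔭 S | p • s = 0})
    (hT₁ : Module.IsTorsion (IwasawaAlgebra p) (XAc W₁ p κ 𝔭 S γ))
    (hg₁ : ∃ g : UnrSeries p,
      (XAc.charIdeal W₁ p κ 𝔭 S γ).map (PowerSeries.map (Halves.toUnr p)) = Ideal.span {g} ∧
        ∃ i : ℕ, ‖((PowerSeries.coeff i g : unrIntegers p) : ℂ_[p])‖ = 1) :
    Module.IsTorsion (IwasawaAlgebra p) (XAc W₂ p κ 𝔭 S γ) ∧
      ∃ g : UnrSeries p,
        (XAc.charIdeal W₂ p κ 𝔭 S γ).map (PowerSeries.map (Halves.toUnr p)) = Ideal.span {g} ∧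
          ∃ i : ℕ, ‖((PowerSeries.coeff i g : unrIntegers p) : ℂ_[p])‖ = 1 :=
  isTorsion_and_exists_generator_of_finite_pTorsion W₂ p κ 𝔭 S γ hS
    (htr (finite_pTorsion_of_isTorsion_of_exists_generator W₁ p κ 𝔭 S γ hS hT₁ hg₁))

end Route

end Summit.BirchSwinnertonDyer.BirchSwinnertonDyer.Theorems.UniversalToricDescentAcDualMuZero

end
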